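import Literature.Analysis.FluidPDE.ElgindiSharpHardy
import HarnessLib

/-!
# Angular `sin(2θ)^{−η}`-weighted bounds and the singular integration-by-parts toolkit of
Elgindi's weighted elliptic estimates ([Elgindi2021] §7.3, Proposition 7.7, Step 2)

Topic `Literature/Analysis/FluidPDE`. Proof file (everything proved, no definitions, no named
facts) on the proof path of the named fact
`Literature.Analysis.FluidPDE.Elgindi.ElgindiGhoulMasmoudi2021_stabilityCore`
(`ElgindiStabilityDecomposition.lean`). T. M. Elgindi, Ann. of Math. 194 (2021) =
arXiv:1904.04795, §7.3, proof of Proposition 7.7, Step 2 "Radial and (weak) angular weights"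
(p. 21 of the held text) multiplies the polar model equation by `−∂_θθΨ·w²/sin(2θ)^η`,
`η = 99/100`, and controls every lower-order ("`E`") term through

> "For `I₅`, that `|Ψ w/sin(2θ)^{η/2}|_{L²} ≤ |∂_θΨ w|_{L²} ≤ |Fw|_{L²}` using the Hardy inequality
> and (7.2) from Step 1. Similarly, for `I₂`, observe that
> `α|R∂_RΨ w/sin(2θ)^{η/2}|_{L²} ≤ Cα|R∂_{Rθ}Ψ w|_{L²} ≤ C|Fw|_{L²}` again using the Hardy inequality
> […] we will denote by `E` an error which changes from line to line but can be controlled in a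
> similar way",

and through integrations by parts in `θ` against the singular weight ("After integrating by parts
in the right way, `I₁` and `I₄` contain positive terms and some terms which we control by the
information we gained from Step 1"). This file provides the one-dimensional (angular) tools, on
the open quarter period `(0, π/2)` and with all weights written as `(…)·sin(2θ)^{−η}`:

* `integral_Ioo_sq_mul_rpow_le_deriv`: **`∫₀^{π/2} f²sin(2θ)^{−η} ≤ 10∫₀^{π/2} f'²`** for `f ∈ C¹`,
  `f(0) = f(π/2) = 0`, `0 ≤ η < 1` ("the Hardy inequality", Lemma 7.2, after `sin^{−η} ≤ sin^{−2}`);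
* `sq_le_integral_sq_add`: the elementary embedding **`g(x)² ≤ (4/π)∫₀^{π/2}g² + (π/2)∫₀^{π/2}g'²`**
  on `[0, π/2]` for `g ∈ C¹` (no boundary condition), and its consequence
  `integral_Ioo_sq_mul_rpow_le_of_contDiff`: **`∫₀^{π/2} g²sin(2θ)^{−η} ≤ (π/(1−η))·((4/π)∫g² + (π/2)∫g'²)`**
  (used for the `sec(θ)Ψ`-terms, which do not vanish at `θ = π/2`);
* the singular integration-by-parts toolkit: `hasDerivAt_sin_two_mul_rpow` (`(sin(2θ)^r)' =
  2r cos(2θ) sin(2θ)^r/sin(2θ)` on `(0, π/2)`), `tendsto_nhdsGT_zero_of_abs_le_rpow` /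
  `tendsto_nhdsLT_zero_of_abs_le_rpow` (a function dominated by `K sin(2θ)^δ`, `δ > 0`, tends to `0`
  at both endpoints) and `integral_Ioo_eq_zero_of_hasDerivAt_of_abs_le_rpow`
  (**`∫₀^{π/2} Φ' = 0`** for such boundary functions `Φ` with integrable derivative).
-/

noncomputable section

open MeasureTheory Set Real Filter intervalIntegral
open _root_.Topology

namespace Literature.Analysis.FluidPDE

namespace Elgindi

/-! ### Dirichlet functions against the weight `sin(2θ)^{−η}`: the Hardy inequality -/

/-- On `(0, π/2)`: `sin(2θ)^{−η} ≤ (sin(2θ)²)⁻¹` for `0 ≤ η ≤ 2`. [folklore] -/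
theorem sin_two_mul_rpow_neg_le_inv_sq {η : ℝ} (hη2 : η ≤ 2) {θ : ℝ} (hθ : θ ∈ Ioo 0 (π / 2)) :
    Real.sin (2 * θ) ^ (-η) ≤ (Real.sin (2 * θ) ^ 2)⁻¹ := by
  have hs : 0 < Real.sin (2 * θ) :=
    Real.sin_pos_of_pos_of_lt_pi (by linarith [hθ.1]) (by linarith [hθ.2])
  have h := Real.rpow_le_rpow_of_exponent_ge hs (Real.sin_le_one _) (by linarith : -(2 : ℝ) ≤ -η)
  rw [Real.rpow_neg hs.le (2 : ℝ), Real.rpow_two] at h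
  exact h

/-- **`∫₀^{π/2} f² sin(2θ)^{−η} ≤ 10∫₀^{π/2} f'²`** for `f ∈ C¹(ℝ)` with `f(0) = f(π/2) = 0` and
`0 ≤ η < 1` ("using the Hardy inequality": Lemma 7.2 and `sin^{−η} ≤ sin^{−2}`).
[cite: Elgindi2021, §7.3 proof of Proposition 7.7, Step 2, estimate of `I₅` (p. 21 of arXiv:1904.04795)] -/
theorem integral_Ioo_sq_mul_rpow_le_deriv {η : ℝ} (hη0 : 0 ≤ η) (hη1 : η < 1) {f : ℝ → ℝ}
    (hf : ContDiff ℝ 1 f) (h0 : f 0 = 0) (h1 : f (π / 2) = 0) :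
    ∫ θ in Ioo 0 (π / 2), f θ ^ 2 * Real.sin (2 * θ) ^ (-η) ≤
      10 * ∫ θ in Ioo 0 (π / 2), deriv f θ ^ 2 := by
  have hb : (0 : ℝ) ≤ π / 2 := by positivity
  have hfc : Continuous f := hf.continuous
  have hdc : Continuous (deriv f) := hf.continuous_deriv le_rfl
  obtain ⟨K, hK0, hK⟩ := exists_abs_le_mul_sin_two_mul hf h0 h1
  -- the Hardy integrand is bounded by `K²`, hence integrable
  have hbound : ∀ θ ∈ Ioo 0 (π / 2), f θ ^ 2 / Real.sin (2 * θ) ^ 2 ≤ K ^ 2 := by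
    intro θ hθ
    have hs : 0 < Real.sin (2 * θ) :=
      Real.sin_pos_of_pos_of_lt_pi (by linarith [hθ.1]) (by linarith [hθ.2])
    rw [div_le_iff₀ (by positivity), ← sq_abs, ← mul_pow]
    exact pow_le_pow_left₀ (abs_nonneg _) (hK θ (Ioo_subset_Icc_self hθ)) 2
  have hmeas : Measurable fun θ : ℝ => f θ ^ 2 / Real.sin (2 * θ) ^ 2 :=
    (hfc.measurable.pow_const 2).div ((by fun_prop : Measurable fun θ : ℝ => Real.sin (2 * θ)).pow_const 2)
  have iH : IntegrableOn (fun θ : ℝ => f θ ^ 2 / Real.sin (2 * θ) ^ 2) (Ioo 0 (π / 2)) := by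
    refine Measure.integrableOn_of_bounded (M := K ^ 2) (by simp) hmeas.aestronglyMeasurable ?_
    rw [ae_restrict_iff' measurableSet_Ioo]
    refine Filter.Eventually.of_forall fun θ hθ => ?_
    rw [Real.norm_eq_abs, abs_of_nonneg (by positivity)]
    exact hbound θ hθ
  have iP := integrableOn_sq_mul_rpow hη0 hη1 hfc
  have h1' : ∫ θ in Ioo 0 (π / 2), f θ ^ 2 * Real.sin (2 * θ) ^ (-η) ≤
      ∫ θ in Ioo 0 (π / 2), f θ ^ 2 / Real.sin (2 * θ) ^ 2 := by
    refine setIntegral_mono_on iP iH measurableSet_Ioo fun θ hθ => ?_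
    rw [div_eq_mul_inv]
    exact mul_le_mul_of_nonneg_left (sin_two_mul_rpow_neg_le_inv_sq (by linarith) hθ) (sq_nonneg _)
  have h2 := angularHardy hf h0 h1
  rw [intervalIntegral.integral_of_le hb, intervalIntegral.integral_of_le hb, integral_Ioc_eq_integral_Ioo,
    integral_Ioc_eq_integral_Ioo] at h2
  exact h1'.trans h2

/-! ### An elementary embedding on `[0, π/2]` -/

/-- **`g(x)² ≤ (4/π)∫₀^{π/2} g² + (π/2)∫₀^{π/2} g'²`** for `g ∈ C¹(ℝ)` and `x ∈ [0, π/2]`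
(from `g(x)² = g(y)² + ∫_y^x 2gg'`, `2|gg'| ≤ (2/π)g² + (π/2)g'²`, averaged over `y`). [folklore] -/
theorem sq_le_integral_sq_add {g : ℝ → ℝ} (hg : ContDiff ℝ 1 g) {x : ℝ} (hx : x ∈ Icc 0 (π / 2)) :
    g x ^ 2 ≤ 4 / π * (∫ θ in Ioo 0 (π / 2), g θ ^ 2) + π / 2 * ∫ θ in Ioo 0 (π / 2), deriv g θ ^ 2 := by
  have hb : (0 : ℝ) < π / 2 := by positivity
  have hd : Differentiable ℝ g := hg.differentiable (by simp)
  have hgc : Continuous g := hg.continuous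
  have hdc : Continuous (deriv g) := hg.continuous_deriv le_rfl
  -- the dominating integrand `k = (2/π)g² + (π/2)g'² ≥ |2gg'|`
  set k : ℝ → ℝ := fun θ => 2 / π * g θ ^ 2 + π / 2 * deriv g θ ^ 2 with hk
  have hkc : Continuous k := by simp only [hk]; fun_prop
  have hk_nn : ∀ θ, 0 ≤ k θ := fun θ => by simp only [hk]; positivity
  have hk_ge : ∀ θ, |2 * g θ * deriv g θ| ≤ k θ := by
    intro θ
    simp only [hk]
    have hπ : 0 < π := Real.pi_pos
    rw [abs_le]
    constructor
    · have h := sq_nonneg (g θ + π / 2 * deriv g θ)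
      have e : 2 / π * g θ ^ 2 + π / 2 * deriv g θ ^ 2 + 2 * g θ * deriv g θ =
          2 / π * (g θ + π / 2 * deriv g θ) ^ 2 := by field_simp; ring
      nlinarith [e, div_nonneg (two_pos.le) hπ.le, mul_nonneg (div_nonneg (two_pos.le) hπ.le) h]
    · have h := sq_nonneg (g θ - π / 2 * deriv g θ)
      have e : 2 / π * g θ ^ 2 + π / 2 * deriv g θ ^ 2 - 2 * g θ * deriv g θ =
          2 / π * (g θ - π / 2 * deriv g θ) ^ 2 := by field_simp; ring
      nlinarith [e, mul_nonneg (div_nonneg (two_pos.le) hπ.le) h]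
  -- `(g²)' = 2gg'`
  have hder : ∀ θ, HasDerivAt (fun y => g y ^ 2) (2 * g θ * deriv g θ) θ := by
    intro θ
    have e2 : (fun y => g y ^ 2) = fun y => g y * g y := by funext y; ring
    rw [e2]
    exact ((hd θ).hasDerivAt.mul (hd θ).hasDerivAt).congr_deriv (by ring)
  have hFTC : ∀ a c : ℝ, ∫ θ in a..c, 2 * g θ * deriv g θ = g c ^ 2 - g a ^ 2 := fun a c =>
    integral_eq_sub_of_hasDerivAt (fun θ _ => hder θ) ((by fun_prop : Continuous fun θ => 2 * g θ * deriv g θ).intervalIntegrable _ _)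
  set Kk : ℝ := ∫ θ in (0 : ℝ)..(π / 2), k θ with hKk
  -- `g(x)² ≤ g(y)² + ∫₀^{π/2} k` for all `y ∈ [0, π/2]`
  have hxy : ∀ y ∈ Icc 0 (π / 2), g x ^ 2 ≤ g y ^ 2 + Kk := by
    intro y hy
    rcases le_total y x with hyx | hxy'
    · have h1 : ∫ θ in y..x, 2 * g θ * deriv g θ ≤ ∫ θ in y..x, k θ :=
        intervalIntegral.integral_mono_on hyx ((by fun_prop : Continuous fun θ => 2 * g θ * deriv g θ).intervalIntegrable _ _)
          (hkc.intervalIntegrable _ _) fun θ _ => (le_abs_self _).trans (hk_ge θ)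
      have h2 : ∫ θ in y..x, k θ ≤ Kk :=
        intervalIntegral.integral_mono_interval hy.1 hyx hx.2 (Filter.Eventually.of_forall fun θ => hk_nn θ)
          (hkc.intervalIntegrable _ _)
      rw [hFTC] at h1
      linarith
    · have h1 : ∫ θ in x..y, -k θ ≤ ∫ θ in x..y, 2 * g θ * deriv g θ :=
        intervalIntegral.integral_mono_on hxy' ((hkc.neg).intervalIntegrable _ _)
          ((by fun_prop : Continuous fun θ => 2 * g θ * deriv g θ).intervalIntegrable _ _)
          fun θ _ => by linarith [neg_abs_le (2 * g θ * deriv g θ), hk_ge θ]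
      have h2 : ∫ θ in x..y, k θ ≤ Kk :=
        intervalIntegral.integral_mono_interval hx.1 hxy' hy.2 (Filter.Eventually.of_forall fun θ => hk_nn θ)
          (hkc.intervalIntegrable _ _)
      rw [hFTC, intervalIntegral.integral_neg] at h1
      linarith
  -- average over `y`
  have iC1 : IntervalIntegrable (fun _ : ℝ => g x ^ 2) volume 0 (π / 2) := intervalIntegrable_const
  have iC2 : IntervalIntegrable (fun _ : ℝ => Kk) volume 0 (π / 2) := intervalIntegrable_const
  have iG2 : IntervalIntegrable (fun y : ℝ => g y ^ 2) volume 0 (π / 2) := (hgc.pow 2).intervalIntegrable _ _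
  have hmono := intervalIntegral.integral_mono_on hb.le iC1 (iG2.add iC2) fun y hy => hxy y hy
  rw [intervalIntegral.integral_const, smul_eq_mul, sub_zero,
    intervalIntegral.integral_add iG2 iC2,
    intervalIntegral.integral_const, smul_eq_mul, sub_zero] at hmono
  have hKk' : Kk = 2 / π * (∫ θ in (0 : ℝ)..(π / 2), g θ ^ 2) + π / 2 * ∫ θ in (0 : ℝ)..(π / 2), deriv g θ ^ 2 := by
    simp only [hKk, hk]
    have iA : IntervalIntegrable (fun θ => 2 / π * g θ ^ 2) volume 0 (π / 2) :=
      (by fun_prop : Continuous fun θ => 2 / π * g θ ^ 2).intervalIntegrable _ _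
    have iB : IntervalIntegrable (fun θ => π / 2 * deriv g θ ^ 2) volume 0 (π / 2) :=
      (by fun_prop : Continuous fun θ => π / 2 * deriv g θ ^ 2).intervalIntegrable _ _
    rw [intervalIntegral.integral_add iA iB, intervalIntegral.integral_const_mul,
      intervalIntegral.integral_const_mul]
  rw [hKk'] at hmono
  rw [intervalIntegral.integral_of_le hb.le, intervalIntegral.integral_of_le hb.le, integral_Ioc_eq_integral_Ioo,
    integral_Ioc_eq_integral_Ioo] at hmono
  have hG : 0 ≤ ∫ θ in Ioo 0 (π / 2), g θ ^ 2 := setIntegral_nonneg measurableSet_Ioo fun θ _ => sq_nonneg _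
  have hD : 0 ≤ ∫ θ in Ioo 0 (π / 2), deriv g θ ^ 2 := setIntegral_nonneg measurableSet_Ioo fun θ _ => sq_nonneg _
  have hπ : 0 < π := Real.pi_pos
  -- `(π/2)g(x)² ≤ G + (π/2)((2/π)G + (π/2)D)` gives `g(x)² ≤ (4/π)G + (π/2)D`
  rw [← sub_nonneg] at hmono ⊢
  have e : 4 / π * (∫ θ in Ioo 0 (π / 2), g θ ^ 2) + π / 2 * (∫ θ in Ioo 0 (π / 2), deriv g θ ^ 2) - g x ^ 2 =
      2 / π * ((∫ θ in Ioo 0 (π / 2), g θ ^ 2) + π / 2 * (2 / π * (∫ θ in Ioo 0 (π / 2), g θ ^ 2) +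
        π / 2 * ∫ θ in Ioo 0 (π / 2), deriv g θ ^ 2) - π / 2 * g x ^ 2) := by
    field_simp; ring
  rw [e]
  exact mul_nonneg (by positivity) hmono

/-- **`∫₀^{π/2} g² sin(2θ)^{−η} ≤ (π/(1−η))·((4/π)∫₀^{π/2}g² + (π/2)∫₀^{π/2}g'²)`** for `g ∈ C¹(ℝ)`,
`0 ≤ η < 1` (the sup bound times `∫₀^{π/2} sin(2θ)^{−η} ≤ π/(1−η)`). [folklore] -/
theorem integral_Ioo_sq_mul_rpow_le_of_contDiff {η : ℝ} (hη0 : 0 ≤ η) (hη1 : η < 1) {g : ℝ → ℝ}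
    (hg : ContDiff ℝ 1 g) :
    ∫ θ in Ioo 0 (π / 2), g θ ^ 2 * Real.sin (2 * θ) ^ (-η) ≤
      π / (1 - η) * (4 / π * (∫ θ in Ioo 0 (π / 2), g θ ^ 2) + π / 2 * ∫ θ in Ioo 0 (π / 2), deriv g θ ^ 2) := by
  set S : ℝ := 4 / π * (∫ θ in Ioo 0 (π / 2), g θ ^ 2) + π / 2 * ∫ θ in Ioo 0 (π / 2), deriv g θ ^ 2 with hS
  have hG : 0 ≤ ∫ θ in Ioo 0 (π / 2), g θ ^ 2 := setIntegral_nonneg measurableSet_Ioo fun θ _ => sq_nonneg _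
  have hD : 0 ≤ ∫ θ in Ioo 0 (π / 2), deriv g θ ^ 2 := setIntegral_nonneg measurableSet_Ioo fun θ _ => sq_nonneg _
  have hS0 : 0 ≤ S := by simp only [hS]; positivity
  have iu := integrableOn_sin_two_mul_rpow (r := -η) (by linarith) (by linarith)
  have iP := integrableOn_sq_mul_rpow hη0 hη1 hg.continuous
  have h1 : ∫ θ in Ioo 0 (π / 2), g θ ^ 2 * Real.sin (2 * θ) ^ (-η) ≤
      ∫ θ in Ioo 0 (π / 2), S * Real.sin (2 * θ) ^ (-η) := by
    refine setIntegral_mono_on iP (iu.const_mul S) measurableSet_Ioo fun θ hθ => ?_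
    have hs : 0 < Real.sin (2 * θ) :=
      Real.sin_pos_of_pos_of_lt_pi (by linarith [hθ.1]) (by linarith [hθ.2])
    exact mul_le_mul_of_nonneg_right (sq_le_integral_sq_add hg (Ioo_subset_Icc_self hθ)) (Real.rpow_nonneg hs.le _)
  rw [MeasureTheory.integral_const_mul] at h1
  have h2 := integral_sin_two_mul_rpow_le (r := -η) (by linarith) (by linarith)
  have h3 : S * (∫ θ in Ioo 0 (π / 2), Real.sin (2 * θ) ^ (-η)) ≤ S * (π / (1 - η)) := by
    rw [show (1 : ℝ) - η = -η + 1 by ring]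
    exact mul_le_mul_of_nonneg_left h2 hS0
  calc _ ≤ S * ∫ θ in Ioo 0 (π / 2), Real.sin (2 * θ) ^ (-η) := h1
    _ ≤ S * (π / (1 - η)) := h3
    _ = π / (1 - η) * S := by ring

/-! ### The singular integration-by-parts toolkit on `(0, π/2)` -/

/-- `(sin(2θ)^r)' = 2r cos(2θ) sin(2θ)^r (sin 2θ)⁻¹` on `(0, π/2)`, any real `r`. [folklore] -/
theorem hasDerivAt_sin_two_mul_rpow (r : ℝ) {θ : ℝ} (hθ : θ ∈ Ioo 0 (π / 2)) :
    HasDerivAt (fun x => Real.sin (2 * x) ^ r)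
      (2 * r * Real.cos (2 * θ) * Real.sin (2 * θ) ^ r * (Real.sin (2 * θ))⁻¹) θ := by
  have hs : 0 < Real.sin (2 * θ) :=
    Real.sin_pos_of_pos_of_lt_pi (by linarith [hθ.1]) (by linarith [hθ.2])
  have h2 : HasDerivAt (fun x : ℝ => 2 * x) 2 θ := by
    simpa using (hasDerivAt_id' θ).const_mul (2 : ℝ)
  have hS : HasDerivAt (fun x => Real.sin (2 * x)) (Real.cos (2 * θ) * 2) θ := h2.sin
  have hU := hS.rpow_const (p := r) (Or.inl hs.ne')
  refine hU.congr_deriv ?_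
  rw [Real.rpow_sub_one hs.ne']
  field_simp

/-- A function dominated by `K sin(2θ)^δ`, `δ > 0`, on `(0, π/2)` tends to `0` at `0⁺`. [folklore] -/
theorem tendsto_nhdsGT_zero_of_abs_le_rpow {Φ : ℝ → ℝ} {K δ : ℝ} (hδ : 0 < δ)
    (h : ∀ θ ∈ Ioo 0 (π / 2), |Φ θ| ≤ K * Real.sin (2 * θ) ^ δ) : Tendsto Φ (𝓝[>] 0) (𝓝 0) := by
  have hb : (0 : ℝ) < π / 2 := by positivity
  have hg : Continuous fun θ : ℝ => K * Real.sin (2 * θ) ^ δ :=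
    continuous_const.mul ((by fun_prop : Continuous fun θ : ℝ => Real.sin (2 * θ)).rpow_const
      fun _ => Or.inr hδ.le)
  have hg0 : K * Real.sin (2 * 0) ^ δ = 0 := by simp [Real.zero_rpow hδ.ne']
  refine squeeze_zero_norm' (a := fun θ => K * Real.sin (2 * θ) ^ δ) ?_ ?_
  · filter_upwards [Ioo_mem_nhdsGT hb] with θ hθ
    rw [Real.norm_eq_abs]; exact h θ hθ
  · have := (hg.tendsto 0).mono_left (nhdsWithin_le_nhds (s := Ioi (0 : ℝ)))
    rwa [hg0] at this

/-- A function dominated by `K sin(2θ)^δ`, `δ > 0`, on `(0, π/2)` tends to `0` at `(π/2)⁻`. [folklore] -/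
theorem tendsto_nhdsLT_zero_of_abs_le_rpow {Φ : ℝ → ℝ} {K δ : ℝ} (hδ : 0 < δ)
    (h : ∀ θ ∈ Ioo 0 (π / 2), |Φ θ| ≤ K * Real.sin (2 * θ) ^ δ) :
    Tendsto Φ (𝓝[<] (π / 2)) (𝓝 0) := by
  have hb : (0 : ℝ) < π / 2 := by positivity
  have hg : Continuous fun θ : ℝ => K * Real.sin (2 * θ) ^ δ :=
    continuous_const.mul ((by fun_prop : Continuous fun θ : ℝ => Real.sin (2 * θ)).rpow_const
      fun _ => Or.inr hδ.le)
  have hgb : K * Real.sin (2 * (π / 2)) ^ δ = 0 := by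
    have : Real.sin (2 * (π / 2)) = 0 := by rw [show 2 * (π / 2) = π by ring, Real.sin_pi]
    simp [this, Real.zero_rpow hδ.ne']
  refine squeeze_zero_norm' (a := fun θ => K * Real.sin (2 * θ) ^ δ) ?_ ?_
  · filter_upwards [Ioo_mem_nhdsLT hb] with θ hθ
    rw [Real.norm_eq_abs]; exact h θ hθ
  · have := (hg.tendsto (π / 2)).mono_left (nhdsWithin_le_nhds (s := Iio (π / 2)))
    rwa [hgb] at this

/-- **Singular integration by parts on the quarter period**: if `Φ' ` is the derivative of `Φ` on
`(0, π/2)`, integrable there, and `|Φ| ≤ K sin(2θ)^δ` with `δ > 0`, then `∫₀^{π/2} Φ' = 0`. [folklore] -/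
theorem integral_Ioo_eq_zero_of_hasDerivAt_of_abs_le_rpow {Φ Φ' : ℝ → ℝ} {K δ : ℝ} (hδ : 0 < δ)
    (hderiv : ∀ θ ∈ Ioo 0 (π / 2), HasDerivAt Φ (Φ' θ) θ) (hint : IntegrableOn Φ' (Ioo 0 (π / 2)))
    (hb : ∀ θ ∈ Ioo 0 (π / 2), |Φ θ| ≤ K * Real.sin (2 * θ) ^ δ) :
    ∫ θ in Ioo 0 (π / 2), Φ' θ = 0 := by
  have hb' : (0 : ℝ) < π / 2 := by positivity
  have h := integral_eq_sub_of_hasDerivAt_of_tendsto hb' hderiv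
    ((intervalIntegrable_iff_integrableOn_Ioo_of_le hb'.le).2 hint)
    (tendsto_nhdsGT_zero_of_abs_le_rpow hδ hb) (tendsto_nhdsLT_zero_of_abs_le_rpow hδ hb)
  rw [intervalIntegral.integral_of_le hb'.le, integral_Ioc_eq_integral_Ioo, sub_zero] at h
  exact h

end Elgindi

end Literature.Analysis.FluidPDE
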